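import Summits.QuantumFields.YangMills.Theorems.FluctuationComparisonRegPrIntLS2BetaSourceEnergyLinearShare
import Summits.QuantumFields.YangMills.Theorems.FluctuationComparisonRegPrIntLS2BetaChartTowerVolumeReadSup
import HarnessLib

/-!
# S2β · (SCT″-c)₁ — «THE LINEAR SOURCE ENERGY IS `β_lin·S′`»: px10 g26's ✓`Elin_le_Sprime` (abstract volume socket `hV`, free `E`) ∘ (L2-VOL) ✓`sum_sq_chartTower_le_vol_readSup_X`
# = the c₁ column's `E_lin` as an `S′`-SHARE with `S′` = ✓p838904 `c1Budget_of_letters`'s dite text VERBATIM: `E_lin ≤ 12·d²·Γ²·Cθ²·S′ ∕ L` (NO gauge condition, NO ℓ²-decay letter)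

Cell `ym3-torus` (YM ladder rung R3 = continuum `SU(2)` Yang–Mills on the three-torus at fixed lattice data — a RUNG: NOT d = 4, NOT infinite volume, NOT a mass gap,
NOT Clay).  Width seat «width 12» `ym3-torus-px12` (gen 27); crux `stmt-QuantumFields-20520`, LINE g18-1 S2β; desk RULING №128 R2∕R4 (2026-09-01T01:23:33Z), architect
RULING «L2-GAUGE» (01:24:54Z) and GO (01:33:26Z (3)(5)).  `--kind proof --supports stmt-QuantumFields-20520 --as helper`, count-neutral, DEFINITION-FREE (0 `def`, 0 `instance`,
0 `notation`, 0 `sorry`, default heartbeats).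

WHAT IS PROVED (sorry-free).  ★★★**`Elin_le_beta_Sprime`**: for the quaternionic chart tower `X` of the station pair `(U₀, e^ζU₀)` (✓`linBudget_of_chartTower`'s `hXdef`), the (BKG)
class relations of ✓`Elin_le_Sprime` (`δ(i+1) ≤ θ_i`, `α(i+1) ≤ kα·θ_i`, `ᾱp(i+1) ≤ kp·θ_i`, `θ_i = Cθ·L^{2i}∕L^{2(K−J)}`, signs):
**`E_lin := 3·Σ_{i<K−J} (L^{K−J−1−(i+1)})²·c̄(i+1)²·(4d²·Σ_{b : PBond (F.P K) i} ‖X i b‖²) ≤ 12·d²·Γ²·Cθ²·S′ ∕ L`** with `Γ` = ✓`Elin_le_Sprime`'s and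
`S′ = Σ_{t<K−J} (if t < K−J then L^t·Σ_{B : PBond (F.P J) 0} ‖𝟙[READ′_t(B)]·g_t‖² else 0)` = ✓p838904's text.  PROOF: `E i := (Σ_b ‖X i b‖²)∕L^{3(K−J−i)}` makes `hV` an identity;
then `Σ_i L^{K−J−1−i}·E i ≤ S′` termwise after the reflection `i = K−J−1−t` (Mathlib ✓`Finset.sum_range_reflect`), each term by (L2-VOL) at `t := K−J−1−i` — the level is
transported to `i` by substitution on a variable (`K − (J+(t+1)) = i`) and the exponent by `(L³)^{t+1} = L^{3(K−J−i)}`.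
USE.  In ✓p838904 `c1Budget_of_letters` take `Bsrc := 3E_lin + 48E_R + 3E_J` (✓`Bsrc_split_le` at the ℓ²-corner size) with THIS file pricing `3E_lin`: the linear sources
move from the purse bracket `W·Bsrc` to the `S′` column as the window-small share `β_lin = (2·(2Cst·κ²νC_b(2L+1))·W)·12d²Γ²Cθ²∕L`, `Cθ = C_B·α₀` (RULING «FB-σ»: window constants last).

HONEST SCOPE.  Exponent∕index bookkeeping over two landed letters; nothing of Bałaban's renormalisation-group analysis is asserted or proved ([Balaban1985Averaging] Prop. 4
(128)–(135) pp.37–38; [Balaban1987RG1] (0.11) p.253); the class relations∕(BKG), `E_R` ((REG)@representative), `E_J` ((SUP-DECAY)₀), (T) are others' HYPOTHESES; (L2-TOWER) is NOT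
proved (false as displayed, HAZARD «L2-GAUGE»); GAP♯∘ (`stub_uniformFibreGapOrbit`, registry 3732b7df UNTOUCHED, 0∕5), S2β, the five registered stubs, crux 20520, 19936, 19200 and
`YM3TorusSU2` are NOT proved; no registered stub is closed; rung R3 — NOT d = 4, NOT infinite volume, NOT a mass gap, NOT Clay; the Yang–Mills mass gap is NOT proved.
-/

set_option autoImplicit false

noncomputable section

open scoped Matrix.Norms.L2Operator
open Finset

namespace Summit.QuantumFields.YangMills.Theorems.FluctuationComparisonRegPrIntLS2BetaSourceEnergyLinearShareOfVol

open Literature.MathematicalPhysics.QuantumFieldTheory.Balaban1983to89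
open Literature.MathematicalPhysics.QuantumFieldTheory.Balaban1983to89.T4Continuum
open Literature.MathematicalPhysics.QuantumFieldTheory.Balaban1983to89.T3ContinuumYM3Torus
open Literature.MathematicalPhysics.QuantumFieldTheory.Balaban1983to89.T3LevelShift
open Literature.MathematicalPhysics.QuantumFieldTheory.Balaban1983to89.T3TiltDescent
open Literature.MathematicalPhysics.QuantumFieldTheory.Balaban1983to89.T3UnitLawDensityEML (ℰp)
open Literature.MathematicalPhysics.QuantumFieldTheory.Balaban1983to89.T4HaarSU2ExpChart (expPoint)
open Literature.MathematicalPhysics.QuantumFieldTheory.Balaban1983to89.T4ExpWindowSmallField (logVec)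
open Literature.MathematicalPhysics.QuantumFieldTheory.Balaban1983to89.HaarExponentialChart
open Literature.MathematicalPhysics.QuantumFieldTheory.Balaban1983to89.BlockAveraging (blockAvg)
open Literature.MathematicalPhysics.QuantumFieldTheory.Balaban1983to89.B14.Eq22Determines (blockIter)
open Literature.MathematicalPhysics.QuantumFieldTheory.Balaban1983to89.B10Eq27TorusAxialLog (rel)
open Literature.MathematicalPhysics.QuantumFieldTheory.Balaban1983to89.B10Eq18SigmaSU2 (su2Coord)
open Literature.MathematicalPhysics.QuantumFieldTheory.Balaban1983to89.B10Eq18SigmaSU2Haar (rev)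
open Literature.MathematicalPhysics.QuantumLattice (su2Quat)
open Summit.QuantumFields.YangMills.Theorems.FluctuationComparisonRegPrIntLS2BetaChartReadDescentOntoExpPoint (su2Coord_rev_mem_lie)
open Summit.QuantumFields.YangMills.Theorems.FluctuationComparisonRegPrIntLS2BetaSourceEnergyLinearShare (Elin_le_Sprime)
open Summit.QuantumFields.YangMills.Theorems.FluctuationComparisonRegPrIntLS2BetaChartTowerVolumeReadSup (sum_sq_chartTower_le_vol_readSup_X)

variable (F : T3Family)

/-- ★★★ **THE LINEAR SOURCE ENERGY IS `β_lin·S′`** — see the module header (`Elin_le_Sprime` with `E i := (Σ_b ‖X i b‖²)∕L^{3(K−J−i)}`, then (L2-VOL) termwise after reflection).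
[cite: Balaban1985Averaging, (2)-(3) p.17, Prop. 4 (128)-(135) pp.37-38; Balaban1987RG1, (0.1)-(0.4), (0.11) pp.251-253] -/
theorem Elin_le_beta_Sprime {J K : ℕ} (hJK : J ≤ K)
    (U₀ : GaugeField (F.P K) 0 (Matrix.specialUnitaryGroup (Fin 2) ℂ)) (ζ : PBond (F.P K) 0 → EuclideanSpace ℝ (Fin 3))
    (X : (i : ℕ) → PBond (F.P K) i → (specialUnitaryLogChart (Fin 2)).lie)
    (hXdef : X = fun (i : ℕ) (b : PBond (F.P K) i) =>
      (⟨su2Coord (rev (logVec (su2Quat (Averaging.iter (fun k => BlockAveraging.blockAvg (P := F.P K) (j := k) ℰp) i (fun ℓ => expPoint (ζ ℓ) * U₀ ℓ : GaugeField (F.P K) 0 (Matrix.specialUnitaryGroup (Fin 2) ℂ)) b * (Averaging.iter (fun k => BlockAveraging.blockAvg (P := F.P K) (j := k) ℰp) i U₀ b)⁻¹)))), su2Coord_rev_mem_lie _⟩ : (specialUnitaryLogChart (Fin 2)).lie))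
    (α δ αpb : ℕ → ℝ) (Cθ kα kp : ℝ)
    (hδ : ∀ i, i < K - J → δ (i + 1) ≤ (Cθ * (F.L : ℝ) ^ (2 * i) / (F.L : ℝ) ^ (2 * (K - J)))) (hα : ∀ i, i < K - J → α (i + 1) ≤ kα * (Cθ * (F.L : ℝ) ^ (2 * i) / (F.L : ℝ) ^ (2 * (K - J))))
    (hαp : ∀ i, i < K - J → αpb (i + 1) ≤ kp * (Cθ * (F.L : ℝ) ^ (2 * i) / (F.L : ℝ) ^ (2 * (K - J))))
    (hδ0 : ∀ i, 0 ≤ δ i) (hα0 : ∀ i, 0 ≤ α i) (hαp0 : ∀ i, 0 ≤ αpb i) :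
    3 * ∑ i ∈ Finset.range (K - J), (F.L : ℝ) ^ (K - J - 1 - (i + 1)) * (F.L : ℝ) ^ (K - J - 1 - (i + 1)) *
          ((((F.P K).L : ℝ) * (((F.P K).L : ℝ) * (2 * δ (i + 1) * (((F.P K).L : ℝ) + 2 * (F.P K).L + 2))) + 48 * α (i + 1) * ((F.P K).L : ℝ) +
            (2 * αpb (i + 1) * ((((F.P K).d + 2) * (F.P K).L : ℕ) : ℝ) + 24 * α (i + 1) * ((((F.P K).d + 2) * (F.P K).L : ℕ) : ℝ)) +
            4 * (404 * ((((F.P K).d + 2) * (F.P K).L : ℕ) : ℝ) * α (i + 1)) + 2 * δ (i + 1) * ((F.P K).L : ℝ) ^ 2) ^ 2 *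
            (4 * ((F.P K).d : ℝ) ^ 2 * ∑ b : PBond (F.P K) i, ‖X i b‖ ^ 2)) ≤
      12 * ((F.P K).d : ℝ) ^ 2 * (2 * ((F.P K).L : ℝ) ^ 2 * (3 * (F.P K).L + 2) + 2 * ((F.P K).L : ℝ) ^ 2 + (48 * (F.P K).L + 24 * ((((F.P K).d + 2) * (F.P K).L : ℕ) : ℝ) + 1616 * ((((F.P K).d + 2) * (F.P K).L : ℕ) : ℝ)) * kα +
        2 * ((((F.P K).d + 2) * (F.P K).L : ℕ) : ℝ) * kp) ^ 2 * Cθ ^ 2 *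
        (∑ t ∈ Finset.range (K - J), (if ht : t < K - J then
          (F.L : ℝ) ^ t * ∑ B : PBond (F.P J) 0,
            ‖(fun ℓ' : PBond (F.P (J + (t + 1))) 0 =>
              if ∃ z : Site (F.P (J + (t + 1))) 0,
                (B14.Eq22Determines.blockIter (t + 1) z = (bondShift (F.sitesPerDir_eq (m := F.m) (K := J) (j := 0) (m' := F.m) (K' := J + (t + 1)) (j' := t + 1) (by omega)) B).src ∨ B14.Eq22Determines.blockIter (t + 1) z = (bondShift (F.sitesPerDir_eq (m := F.m) (K := J) (j := 0) (m' := F.m) (K' := J + (t + 1)) (j' := t + 1) (by omega)) B).tgt) ∧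
                ∀ ν, (B10Eq27TorusAxialLog.rel z ℓ'.src ν).natAbs ≤ 2
              then logVec (su2Quat (descendTo F ℰp (J + (t + 1)) K (by omega) (fun ℓ => expPoint (ζ ℓ) * U₀ ℓ : GaugeField (F.P K) 0 (Matrix.specialUnitaryGroup (Fin 2) ℂ)) ℓ' * (descendTo F ℰp (J + (t + 1)) K (by omega) U₀ ℓ')⁻¹)) else 0)‖ ^ 2
        else 0)) / (F.L : ℝ) := by
  have hL2' : (2 : ℝ) ≤ (F.L : ℝ) := by exact_mod_cast F.hL.2
  have hL0 : (0 : ℝ) < (F.L : ℝ) := by linarith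
  -- (1) px10's abstract share with the volume socket filled by `E i := (Σ_b ‖X i b‖²) / L^{3(K−J−i)}`
  have hmain := Elin_le_Sprime F X α δ αpb Cθ kα kp hδ hα hαp hδ0 hα0 hαp0
    (fun i => (∑ b : PBond (F.P K) i, ‖X i b‖ ^ 2) / (F.L : ℝ) ^ (3 * (K - J - i)))
    (fun i _ => by rw [mul_div_cancel₀ _ (pow_ne_zero _ hL0.ne')])
  refine hmain.trans ?_
  have hΓ0 : 0 ≤ 12 * ((F.P K).d : ℝ) ^ 2 * (2 * ((F.P K).L : ℝ) ^ 2 * (3 * (F.P K).L + 2) + 2 * ((F.P K).L : ℝ) ^ 2 + (48 * (F.P K).L + 24 * ((((F.P K).d + 2) * (F.P K).L : ℕ) : ℝ) + 1616 * ((((F.P K).d + 2) * (F.P K).L : ℕ) : ℝ)) * kα +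
        2 * ((((F.P K).d + 2) * (F.P K).L : ℕ) : ℝ) * kp) ^ 2 * Cθ ^ 2 := by positivity
  refine div_le_div_of_nonneg_right (mul_le_mul_of_nonneg_left ?_ hΓ0) hL0.le
  -- (2) the brackets: `Σ_i L^{K−J−1−i}·E i ≤ S′`, termwise after the reflection `t = K−J−1−i`
  conv_rhs => rw [← Finset.sum_range_reflect]
  refine Finset.sum_le_sum fun i hi => ?_
  have hi' : i < K - J := Finset.mem_range.1 hi
  beta_reduce
  rw [dif_pos (show K - J - 1 - i < K - J by omega)]
  refine mul_le_mul_of_nonneg_left ?_ (pow_nonneg hL0.le _)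
  rw [div_le_iff₀ (pow_pos hL0 _)]
  -- (3) (L2-VOL) at `t := K−J−1−i`, its level transported to `i`, its exponent to `3(K−J−i)`
  have h1 := sum_sq_chartTower_le_vol_readSup_X F (J := J) (K := K) (t := K - J - 1 - i) (by omega) U₀ ζ X hXdef
  have key : ∀ n : ℕ, n = i → ∀ R : ℝ, (∑ b : PBond (F.P K) n, ‖X n b‖ ^ 2 ≤ R) → ∑ b : PBond (F.P K) i, ‖X i b‖ ^ 2 ≤ R := by
    rintro n rfl R h; exact h
  have h2 := key _ (by omega) _ h1
  refine h2.trans (le_of_eq ?_)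
  rw [← pow_mul, show 3 * (K - J - 1 - i + 1) = 3 * (K - J - i) from by omega]
  exact mul_comm _ _

end Summit.QuantumFields.YangMills.Theorems.FluctuationComparisonRegPrIntLS2BetaSourceEnergyLinearShareOfVol

end
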